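import Literature.Analysis.FluidPDE.PassiveVectorLionsExtract
import Literature.Analysis.FluidPDE.PassiveVectorL2WeakBound
import Literature.Analysis.FluidPDE.PassiveScalarExistenceApprox
import Literature.Analysis.FunctionSpaces.TorusSpaceTimeFields
import HarnessLib

/-!
# Existence of weak solutions of the passive solenoidal vector equation (J.-L. Lions' theorem)

Analysis/FluidPDE file (everything proved; no definitions, no named facts). **Existence in the class
`Torus.IsWeakPassiveVectorOn 0 T ν b w₀`** (Yoshida–Kaneda 2000, (4)–(5): `∂ₜw + (b·∇)w + ∇π = νΔw`,
`∇·w = 0`, `w(0) = w₀`) for `T > 0`, `ν > 0`, an essentially bounded carrier `b ∈ L^∞((0,T) × T^d)` that is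
weakly divergence free for a.e. `t`, and a weakly divergence-free datum `w₀ ∈ L²(T^d)`
(`exists_isWeakPassiveVectorOn`). The proof is J.-L. Lions' Hilbert-space method (Lions–Magenes 1972,
Chap. 3, Thm. 1.1 and §4; Temam 1984, Ch. III §1): the damped solution `v ∈ L²(μ_T)` in the closed span of
the divergence-free tests (`PassiveVectorLionsWeak.exists_dampedWeak_mem_closure`) has weakly divergence-free
`L²` slices (`PassiveVectorLionsExtract.ae_isWeaklyDivFree_of_mem_closure`); `w = eᵗ v` solves the undamped
weak formulation (`PassiveVectorTestOperator.undamped_weak_of_damped`); the Galerkin energy argument gives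
`w ∈ L^∞_t L²_x` (`PassiveVectorL2WeakBound.ae_integral_norm_sq_le_of_weak`); the remaining fields of the class
(measurability of the space–time lift, `b ∈ L¹_t L²_x`, `|b||w| ∈ L¹`) are bookkeeping. Consumer: stub
`stub_existence` of support item `CascadeBookkeeping` (route `SolenoidalFractalHomogenisation`, cell `ad-ideate`).

## References

* J.-L. Lions, E. Magenes, *Non-homogeneous boundary value problems and applications* I (1972), Chap. 3,
  Thm. 1.1, §4.3. [`LionsMagenes1972`]
* R. Temam, *Navier–Stokes Equations*, 3rd ed. (1984), Ch. III §1, Thm. 1.1. [`Temam1984`]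
* K. Yoshida, Y. Kaneda, Phys. Rev. E 63 (2000) 016308, §II eq. (4)–(5). [`YoshidaKaneda2000`]
-/

noncomputable section

open MeasureTheory Set Filter Function TopologicalSpace
open scoped ENNReal NNReal InnerProductSpace Topology

namespace Literature.Analysis.FluidPDE

namespace Torus

variable {d : Type*} [Fintype d]

section Prelim

/-- Almost every point of `(vol|(0,T)) ⊗ vol` has its time coordinate in `(0,T)`. [folklore] -/
private theorem ae_fst_mem_Ioo₄ (T : ℝ) :
    ∀ᵐ p : ℝ × UnitAddTorus d ∂(((volume : Measure ℝ).restrict (Ioo 0 T)).prod volume), p.1 ∈ Ioo 0 T :=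
  (Measure.quasiMeasurePreserving_fst (μ := (volume : Measure ℝ).restrict (Ioo 0 T))
    (ν := (volume : Measure (UnitAddTorus d)))).ae (ae_restrict_mem measurableSet_Ioo)

/-- Constant multiples of weakly divergence-free fields are weakly divergence free. [folklore] -/
private theorem isWeaklyDivFree_const_smul₄ {u : UnitAddTorus d → EuclideanSpace ℝ d}
    (hu : FunctionSpaces.Torus.IsWeaklyDivFree u) (c : ℝ) :
    FunctionSpaces.Torus.IsWeaklyDivFree (fun x => c • u x) := by
  intro θ hθ
  simp only [real_inner_smul_left, integral_const_mul, hu θ hθ, mul_zero]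

/-- Pairings of two `L²` fields are integrable. [folklore] -/
private theorem integrable_inner_of_memLp_two₄ {X : Type*} [MeasurableSpace X] {μ : Measure X}
    {a g : X → EuclideanSpace ℝ d} (ha : MemLp a 2 μ) (hg : MemLp g 2 μ) :
    Integrable (fun x => ⟪a x, g x⟫_ℝ) μ :=
  (ha.norm.integrable_mul hg.norm).mono' (ha.aestronglyMeasurable.inner hg.aestronglyMeasurable)
    (ae_of_all _ fun x => norm_inner_le_norm (a x) (g x))

end Prelim

section Existence

variable [DecidableEq d]

/-- **Existence of weak solutions of the passive solenoidal vector equation** (J.-L. Lions' theorem): for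
`T > 0`, `ν > 0`, a carrier `b ∈ L^∞((0,T) × T^d)` (space–time lift) that is weakly divergence free for
a.e. `t ∈ (0,T)`, and a weakly divergence-free datum `w₀ ∈ L²(T^d)`, there is a weak solution `w` of
`∂ₜw + (b·∇)w + ∇π = νΔw`, `∇·w = 0`, `w(0) = w₀` in the class `IsWeakPassiveVectorOn 0 T ν b w₀`
(Lions–Magenes 1972, Chap. 3, Thm. 1.1, applied as in Temam 1984, Ch. III §1, Thm. 1.1; the `L^∞_t L²_x` bound by
the Galerkin energy argument). [cite: LionsMagenes1972, Chap. 3 Thm. 1.1] -/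
theorem exists_isWeakPassiveVectorOn {T ν : ℝ} (hT : 0 < T) (hν : 0 < ν)
    {b : ℝ → UnitAddTorus d → EuclideanSpace ℝ d}
    (hb : MemLp (FunctionSpaces.Torus.stLift b) ∞ (volume.restrict (Ioo 0 T ×ˢ univ)))
    (hbdiv : ∀ᵐ t ∂(volume.restrict (Ioo 0 T)), FunctionSpaces.Torus.IsWeaklyDivFree (b t))
    {w₀ : UnitAddTorus d → EuclideanSpace ℝ d} (hw₀ : MemLp w₀ 2 volume)
    (hdiv₀ : FunctionSpaces.Torus.IsWeaklyDivFree w₀) :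
    ∃ w : ℝ → UnitAddTorus d → EuclideanSpace ℝ d, IsWeakPassiveVectorOn 0 T ν b w₀ w := by
  set μ : Measure (ℝ × UnitAddTorus d) := ((volume : Measure ℝ).restrict (Ioo 0 T)).prod volume with hμ
  -- the carrier read on `(0,T) × T^d`
  have hbm : AEStronglyMeasurable (uncurry b) μ := by
    have h := FunctionSpaces.Torus.aestronglyMeasurable_uncurry_of_stLift_restrict hb.aestronglyMeasurable
    rwa [Measure.volume_eq_prod, ← Measure.prod_restrict, Measure.restrict_univ] at h
  obtain ⟨M, hM, hbM'⟩ := ae_norm_le_prod_of_memLp_top_stLift hb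
  have hbM : ∀ᵐ p ∂μ, ‖uncurry b p‖ ≤ M := hbM'
  have hbMt : ∀ᵐ t ∂(volume.restrict (Ioo 0 T)), ∀ᵐ x ∂volume, ‖b t x‖ ≤ M :=
    Measure.ae_ae_of_ae_prod hbM'
  -- J.-L. Lions: the damped solution in the closed span of the divergence-free tests
  obtain ⟨v, hvF, hvweak⟩ := exists_dampedWeak_mem_closure (ν := ν) hT hν.le hbm hbM hbdiv hw₀
  set V : ℝ × UnitAddTorus d → EuclideanSpace ℝ d := (v : ℝ × UnitAddTorus d → EuclideanSpace ℝ d) with hV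
  have hVm : MemLp V 2 μ := Lp.memLp v
  -- the undamped field `w = eᵗ v`
  set w : ℝ → UnitAddTorus d → EuclideanSpace ℝ d := fun t x => Real.exp t • V (t, x) with hw
  have hslice := ae_isWeaklyDivFree_of_mem_closure hvF
  have hw2s : ∀ᵐ t ∂(volume.restrict (Ioo 0 T)), MemLp (w t) 2 volume := by
    filter_upwards [hslice] with t ht
    exact ht.1.const_smul (Real.exp t)
  have hdivw : ∀ᵐ t ∂(volume.restrict (Ioo 0 T)), FunctionSpaces.Torus.IsWeaklyDivFree (w t) := by
    filter_upwards [hslice] with t ht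
    exact isWeaklyDivFree_const_smul₄ ht.2 (Real.exp t)
  have hwm : AEStronglyMeasurable (uncurry w) μ :=
    (Real.continuous_exp.comp continuous_fst).aestronglyMeasurable.smul hVm.aestronglyMeasurable
  have hw2 : MemLp (uncurry w) 2 μ := by
    refine MemLp.of_le_mul (c := Real.exp T) hVm hwm ?_
    filter_upwards [ae_fst_mem_Ioo₄ (d := d) T] with p hp
    show ‖Real.exp p.1 • V (p.1, p.2)‖ ≤ Real.exp T * ‖V p‖
    rw [Prod.mk.eta, norm_smul, Real.norm_eq_abs, abs_of_pos (Real.exp_pos _)]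
    exact mul_le_mul_of_nonneg_right (Real.exp_le_exp.2 hp.2.le) (norm_nonneg _)
  have hw1 : Integrable (uncurry w) μ := hw2.integrable one_le_two
  -- the undamped weak formulation
  have hweak : ∀ Ψ : ℝ → UnitAddTorus d → EuclideanSpace ℝ d, FunctionSpaces.Torus.IsSpaceTimeTest T Ψ →
      (∀ t, FunctionSpaces.Torus.IsDivFree (Ψ t)) →
      (∫ p, ⟪w p.1 p.2, FunctionSpaces.Torus.timeDeriv Ψ p.1 p.2 +
          FunctionSpaces.Torus.convect (b p.1) (Ψ p.1) p.2 + ν • FunctionSpaces.Torus.laplacian (Ψ p.1) p.2⟫_ℝ ∂μ) +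
        ∫ x, ⟪w₀ x, Ψ 0 x⟫_ℝ = 0 := fun Ψ hΨ hΨdiv =>
    undamped_weak_of_damped hvweak hΨ hΨdiv
  -- the `L^∞_t L²_x` bound (Galerkin energy argument)
  have hbound := ae_integral_norm_sq_le_of_weak hν hw2 hw2s hdivw hbm hM hbM hbdiv hweak hw₀ hdiv₀
  set K : ℝ := (∫ x, ‖w₀ x‖ ^ 2) +
    2 * ((Fintype.card d * M) ^ 2 / ν) * ∫ p, ‖uncurry w p‖ ^ 2 ∂μ with hK
  refine ⟨w,
    { aestronglyMeasurable := FunctionSpaces.Torus.aestronglyMeasurable_stLift_of_uncurry hwm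
      aestronglyMeasurable_carrier := hb.aestronglyMeasurable
      ae_lintegral_sq_le := ?_
      lintegral_carrier_lt_top := ?_
      lintegral_mul_lt_top := ?_
      ae_isWeaklyDivFree_carrier := hbdiv
      ae_isWeaklyDivFree := hdivw
      weak_eq := ?_ }⟩
  · -- `w ∈ L^∞(0,T; L²)`
    refine ⟨K.toNNReal, ?_⟩
    filter_upwards [hbound, hw2s] with t ht hm2
    have e : ∫⁻ x, ‖w t x‖ₑ ^ 2 = ENNReal.ofReal (∫ x, ‖w t x‖ ^ 2) := by
      rw [ofReal_integral_eq_lintegral_ofReal (hm2.integrable_norm_pow two_ne_zero)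
        (ae_of_all _ fun x => by positivity)]
      refine lintegral_congr_ae (ae_of_all _ fun x => ?_)
      dsimp only
      rw [ENNReal.ofReal_pow (norm_nonneg _), ofReal_norm]
    rw [e]
    exact ENNReal.ofReal_le_ofReal ht
  · -- `b ∈ L¹(0,T; L²)`
    calc ∫⁻ t in Ioo 0 T, (∫⁻ x, ‖b t x‖ₑ ^ 2) ^ (1 / 2 : ℝ)
        ≤ ∫⁻ _ in Ioo 0 T, ENNReal.ofReal M := by
          refine lintegral_mono_ae ?_
          filter_upwards [hbMt] with t ht
          calc (∫⁻ x, ‖b t x‖ₑ ^ 2) ^ (1 / 2 : ℝ)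
              ≤ (∫⁻ _ : UnitAddTorus d, ENNReal.ofReal M ^ 2) ^ (1 / 2 : ℝ) := by
                refine ENNReal.rpow_le_rpow (lintegral_mono_ae ?_) (by norm_num)
                filter_upwards [ht] with x hx
                gcongr
                rw [← ofReal_norm]
                exact ENNReal.ofReal_le_ofReal hx
            _ = ENNReal.ofReal M := by
                rw [lintegral_const, measure_univ, mul_one,
                  show (1 / 2 : ℝ) = ((2 : ℕ) : ℝ)⁻¹ by norm_num, ENNReal.pow_rpow_inv_natCast two_ne_zero]
      _ < ⊤ := by
          rw [lintegral_const, Measure.restrict_apply_univ]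
          exact ENNReal.mul_lt_top ENNReal.ofReal_lt_top measure_Ioo_lt_top
  · -- `|b| |w| ∈ L¹((0,T) × T^d)`
    have h2 : ∫⁻ p, ‖uncurry w p‖ₑ ∂μ = ∫⁻ t in Ioo 0 T, ∫⁻ x, ‖w t x‖ₑ :=
      lintegral_prod _ hwm.enorm
    calc ∫⁻ t in Ioo 0 T, ∫⁻ x, ‖b t x‖ₑ * ‖w t x‖ₑ
        ≤ ∫⁻ t in Ioo 0 T, ∫⁻ x, ENNReal.ofReal M * ‖w t x‖ₑ := by
          refine lintegral_mono_ae ?_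
          filter_upwards [hbMt] with t ht
          refine lintegral_mono_ae ?_
          filter_upwards [ht] with x hx
          gcongr
          rw [← ofReal_norm]
          exact ENNReal.ofReal_le_ofReal hx
      _ = ENNReal.ofReal M * ∫⁻ p, ‖uncurry w p‖ₑ ∂μ := by
          rw [h2, ← lintegral_const_mul' _ _ ENNReal.ofReal_ne_top]
          refine lintegral_congr_ae (ae_of_all _ fun t => ?_)
          dsimp only
          rw [lintegral_const_mul' _ _ ENNReal.ofReal_ne_top]
      _ < ⊤ := ENNReal.mul_lt_top ENNReal.ofReal_lt_top hw1.hasFiniteIntegral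
  · -- the weak formulation
    intro Ψ hΨ hΨdiv
    have hOp : MemLp (fun p : ℝ × UnitAddTorus d => FunctionSpaces.Torus.timeDeriv Ψ p.1 p.2 +
        FunctionSpaces.Torus.convect (b p.1) (Ψ p.1) p.2 + ν • FunctionSpaces.Torus.laplacian (Ψ p.1) p.2) 2 μ := by
      refine ((memLp_two_dampedOp (ν := ν) hΨ hbm hbM).add hΨ.memLp_two_uncurry).ae_eq
        (ae_of_all _ fun p => ?_)
      simp only [Pi.add_apply, Function.uncurry]
      abel
    have hint : Integrable (fun p : ℝ × UnitAddTorus d => ⟪w p.1 p.2, FunctionSpaces.Torus.timeDeriv Ψ p.1 p.2 +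
        FunctionSpaces.Torus.convect (b p.1) (Ψ p.1) p.2 + ν • FunctionSpaces.Torus.laplacian (Ψ p.1) p.2⟫_ℝ) μ :=
      integrable_inner_of_memLp_two₄ hw2 hOp
    have hprod : ∫ t in Ioo 0 T, ∫ x, ⟪w t x, FunctionSpaces.Torus.timeDeriv Ψ t x +
          FunctionSpaces.Torus.convect (b t) (Ψ t) x + ν • FunctionSpaces.Torus.laplacian (Ψ t) x⟫_ℝ =
        ∫ p, ⟪w p.1 p.2, FunctionSpaces.Torus.timeDeriv Ψ p.1 p.2 +
          FunctionSpaces.Torus.convect (b p.1) (Ψ p.1) p.2 + ν • FunctionSpaces.Torus.laplacian (Ψ p.1) p.2⟫_ℝ ∂μ :=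
      (integral_prod _ hint).symm
    simp only [zero_mul, add_zero]
    rw [hprod]
    exact hweak Ψ hΨ hΨdiv

end Existence

end Torus

end Literature.Analysis.FluidPDE

end
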